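import Summits.QuantumFields.BalabanUV.Beta.D1BFx.VectorLegKernelForm
import Summits.QuantumFields.BalabanUV.Beta.D1BFx.StencilDictionaryEntries

/-!
# `BalabanUV.Beta.D1BFx.VectorPropagatorImages` — road «BF-x» for binder row D1, slot (K), `K-ASSEMBLY-SPEC.md` brick TB2 (N-side), part 2:
# **THE METHOD OF IMAGES FOR THE MASSIVE VECTOR PROPAGATOR** — on every cubic fine torus of side `(m+1)·p`, an5's torus propagator IS the
# periodisation of the reduced BF gluon leg: `Σ_{t ∈ ℤ⁴} Ga (m+1) a x (y + (m+1)p·t) κ l = (m+1)²·Re calG_T((x̄,κ),(ȳ,l))`, MODULO the exponential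
# decay `Spr (Ga (m+1) a)` (the printed [B5, Prop. 1.2] ∧ [B5, (1.126)–(1.127)] input of the road, `GluonLegTails.spr_Ga_of_prop12`)

HONEST FRAMING (cell contract, verbatim): «discharging `BetaPertH` makes Bałaban's UV stability UNCONDITIONAL — a real constructive-QFT
result; it is NOT the continuum limit and NOT the Clay problem.»  HONEST DEPENDENCY (verbatim): «continuum YM on T⁴ ⇐ BetaPertH ∧ nine
spine estimates (0/9 proved); BetaPertH ⇐ (D1) ∧ (D4) ∧ CAP+tail; G-an2-4 gates asym, D1 and NE2/3/4.»  THIS MODULE DISCHARGES NOTHING of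
D1 / BetaPertH: [folklore] composition BY NAME of this lineage's `VectorLegKernelForm.compF_X1aKer_GaF` (X₁a in kernel form), leaf-03-g7's
`FibredPeriodisation.lemma222F` / `periodise₂_compKer_matrix` (an4's Lemma 2.2.2 machinery) and `GaugeSandwich.DeltaA_eq_periodisedProjector`,
gan24-leaf-06-g28's `StencilDictionaryEntries` (`Lap_eq_periodiseF_site`, `QvAdj_QvOp_eq_periodiseF_site`, `GradOp(_conjTranspose)_entry_site`) and
`StencilKernels`, an5's `B5DeltaA169.DeltaA_mul_calG` + `B5RealFields` (real entries) + `VectorPropagatorLimit.isPeriodic₂_KinfBlock`.  The decay of `Ga` is a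
DISPLAYED hypothesis `hGa : Spr (Ga (m+1) a)` (NOT in the tree unconditionally: it is the printed B5 Prop. 1.2 content); nothing else is assumed, nothing is cited,
one data `def` with a body ([our object] `gaugeF`), 0 sorry.  NOT summit progress; NOT BetaPertH, NOT continuum, NOT Clay.

ABSOLUTE RULE (cell, verbatim): «No internally-minted statement may enter as a cited fact. Every hypothesis is either kernel-proved in this
package or a verbatim quotation of a PUBLISHED theorem with page reference. The manuscript(s) under audit are NOT citable for their own
disputed steps — they are the thing under adjudication; programme-internal (2001/route/tribunal) claims are never citable.»

WHY (`HOME/b2b-balaban-beta-d1-p2/K-ASSEMBLY-SPEC.md` v1 §1 TB2).  The N-legs of the slice-transfer identity on a torus are finite Woodbury expressions in the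
torus massive propagator; this file identifies that propagator with the periodised `ℤ⁴` leg `Ga = K^∞`, so the torus N-legs are periodisations of the road's
`ℤ⁴` legs and TA3's trace limits apply.  (an5's `VectorPropagatorLimit` scope note records that the images identity is FALSE as an absolutely convergent
statement WITHOUT a decay input — the rows of the three explicit terms of `K^∞` are not summable separately; with `Spr (Ga …)`, i.e. the printed decay of
the SUM, the rows are summable and the identity holds, as proved here.)

CONTENT (`m`, `a > 0`, coarse period `p`, fine torus `Site 4 ((m+1)·p)` = `Tor (fine (m+1) (cubic 4 p))`; all [folklore] / [our object]).
* §1 `gaugeF m a` (the four-point `P` kernel), `tsum_Pker_mul_codiffKer`, `compKer_dzKer_Pker_codiffKer` (`dzKer κ ∘ P ∘ codiffKer l = gaugeF`), `Kfib_X1aKer`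
  (`X1aKer (m+1) a a′ = lapF + a′·qqF − gaugeF` fibrewise), row summabilities.
* §2 `rowBound_codiffKer`; **`gauge_sandwich_entry`**: `(GradOp·P̂_ℂ·GradOpᴴ) i j = ↑((m+1)²·periodiseF s (gaugeF m a) i j)` (two product rules).
* §3 **`DeltaA_eq_periodiseF`**: `DeltaA (m+1) (cubic 4 p) a i j = ↑((m+1)²·periodiseF s (X1aKer (m+1) a (a/(m+1)⁸)) i j)`.
* §4 `isPeriodic₂_GaF`, `rowBound_GaF` (from `hGa`), `summable_abs_X1aKer`, and Lemma 2.2.2: `periodiseF_X1aKer_mul_GaF`.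
* §5 **`periodiseF_GaF_eq_calG_re`** (torus indices) and **`images_Ga_eq_calG_re`** (`ℤ⁴` coordinates: the METHOD OF IMAGES).
Unit `b2b-balaban-beta-d1-p2` (road owner, gen 5).
-/

namespace Summit.QuantumFields.BalabanUV.Beta.D1BFx.VectorPropagatorImages

open Finset Matrix
open scoped BigOperators
open Literature.MathematicalPhysics.QuantumFieldTheory.Balaban1983to89
open Literature.MathematicalPhysics.QuantumFieldTheory.Balaban1983to89.Beta
open B5Prop11Plancherel (Tor fine calG)
open B5Prop11Lattice (gammaZero)
open B5Prop11Lower (Lap)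
open B5Action121 (GradOp)
open B5Block118 (QvOp)
open B5DeltaA169 (QvAdj DeltaA DeltaA_mul_calG)
open B5RealFields (IsReal reM reM_apply reM_one isReal_DeltaA)
open VectorTails (castT)
open FreeLegDictionary (cubic)
open VectorPropagatorLimit (Kinf calG_im_eq_zero isPeriodic₂_KinfBlock)
open AffineAveraging (unitVec)
open B6QGQLower276 (X lapKer)
open ExpKernelCalculus (Decays)
open B12Sec2to5 (l1)
open Summit.QuantumFields.BalabanUV.Beta.TameKernelCalculus (Spr)
open Summit.QuantumFields.BalabanUV.Beta.D1BFx.RProjector (Pker Pgt Pgt_apply)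
open Summit.QuantumFields.BalabanUV.Beta.D1BFx.GluonLeg (Ga Ga_apply)
open Summit.QuantumFields.BalabanUV.Beta.D1BFx.StencilKernels (dzKer codiffKer qqKer isPeriodic₂_dzKer isPeriodic₂_codiffKer summable_dzKer_row
  summable_codiffKer_row isPeriodic₂_lapKer summable_abs_lapKer_row summable_abs_qqKer_row)
open Summit.QuantumFields.BalabanUV.Beta.D1BFx.StencilDictionaryEntries (lapF qqF Kfib_lapF Kfib_qqF Lap_eq_periodiseF_site QvAdj_QvOp_eq_periodiseF_site
  GradOp_entry_site GradOp_conjTranspose_entry_site)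
open Summit.QuantumFields.BalabanUV.Beta.D1BFx.PeriodisedKernels (isPeriodic₂_Pker rowBound_Pker summable_abs_row_Pker)
open Summit.QuantumFields.BalabanUV.Beta.D1BFx.PeriodisedProjector (Phat Phat_apply)
open Summit.QuantumFields.BalabanUV.Beta.D1BFx.GaugeSandwich (PhatC PhatC_eq DeltaA_eq_periodisedProjector)
open Summit.QuantumFields.BalabanUV.Beta.D1BFx.FibredPeriodisation (FKer Kfib Kfib_apply compF kdeltaF periodiseF periodiseF_apply lemma222F
  periodise₂_compKer_matrix rowBound_compKer isPeriodic₂_compKer summable_abs_compKer)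
open Summit.QuantumFields.BalabanUV.Beta.D1BFx.VectorLegKernelForm (X1aKer GaF X1aKer_apply GaF_apply compF_X1aKer_GaF)

noncomputable section

variable (m : ℕ) (a : ℝ)

/-! ## §1 The four-point gauge kernel and the fibres of `X1aKer` -/

/-- [our object] **THE FOUR-POINT GAUGE KERNEL** `gaugeF m a (x,κ) (w,l) := P(x+e_κ, w+e_l) − P(x+e_κ, w) − P(x, w+e_l) + P(x, w)`, `P = Pker m a`
(`= dzKer κ ∘ P ∘ codiffKer l`, the kernel of `dz ∘ Pf ∘ codiff₁` at block side `m + 1`). -/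
def gaugeF : FKer 4 (Fin 4) (Fin 4) := fun i j =>
  Pker m a (i.1 + unitVec i.2) (j.1 + unitVec j.2) - Pker m a (i.1 + unitVec i.2) j.1 - Pker m a i.1 (j.1 + unitVec j.2) + Pker m a i.1 j.1

variable {m a}

/-- [folklore] `P ∘ codiffKer l` entrywise: `Σ'_r P(q,r)·codiffKer l r w = P(q, w+e_l) − P(q, w)` (two surviving terms). -/
theorem tsum_Pker_mul_codiffKer (q w : X 4) (l : Fin 4) :
    ∑' r : X 4, Pker m a q r * codiffKer l r w = Pker m a q (w + unitVec l) - Pker m a q w := by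
  have e : ∀ r : X 4, Pker m a q r * codiffKer l r w
      = (if r = w + unitVec l then Pker m a q r else 0) - (if r = w then Pker m a q r else 0) := by
    intro r
    rw [StencilKernels.codiffKer_eq_dzKer_swap]
    simp only [dzKer, mul_sub, mul_ite, mul_one, mul_zero]
  have h1 : Summable fun r : X 4 => (if r = w + unitVec l then Pker m a q r else 0) :=
    summable_of_ne_finset_zero (s := {w + unitVec l}) fun r hr => by rw [Finset.mem_singleton] at hr; exact if_neg hr
  have h2 : Summable fun r : X 4 => (if r = w then Pker m a q r else 0) :=
    summable_of_ne_finset_zero (s := {w}) fun r hr => by rw [Finset.mem_singleton] at hr; exact if_neg hr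
  rw [tsum_congr e, h1.tsum_sub h2, tsum_eq_single (w + unitVec l) (fun r hr => if_neg hr),
    tsum_eq_single w (fun r hr => if_neg hr), if_pos rfl, if_pos rfl]

/-- [folklore] **`dzKer κ ∘ P ∘ codiffKer l = gaugeF`** as `ℤ⁴` kernels. -/
theorem compKer_dzKer_Pker_codiffKer (κ l : Fin 4) :
    compKer (dzKer κ) (compKer (Pker m a) (codiffKer l)) = Kfib (gaugeF m a) κ l := by
  funext x w
  simp only [compKer, Kfib_apply, gaugeF, tsum_Pker_mul_codiffKer]
  have e : ∀ q : X 4, dzKer κ x q * (Pker m a q (w + unitVec l) - Pker m a q w)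
      = (if q = x + unitVec κ then Pker m a q (w + unitVec l) - Pker m a q w else 0)
        - (if q = x then Pker m a q (w + unitVec l) - Pker m a q w else 0) := by
    intro q
    simp only [dzKer, sub_mul, ite_mul, one_mul, zero_mul]
  have h1 : Summable fun q : X 4 => (if q = x + unitVec κ then Pker m a q (w + unitVec l) - Pker m a q w else 0) :=
    summable_of_ne_finset_zero (s := {x + unitVec κ}) fun q hq => by rw [Finset.mem_singleton] at hq; exact if_neg hq
  have h2 : Summable fun q : X 4 => (if q = x then Pker m a q (w + unitVec l) - Pker m a q w else 0) :=
    summable_of_ne_finset_zero (s := {x}) fun q hq => by rw [Finset.mem_singleton] at hq; exact if_neg hq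
  rw [tsum_congr e, h1.tsum_sub h2, tsum_eq_single (x + unitVec κ) (fun q hq => if_neg hq),
    tsum_eq_single x (fun q hq => if_neg hq), if_pos rfl, if_pos rfl]
  ring

/-- [folklore] **THE FIBRES OF `X1aKer`**: `Kfib (X1aKer (m+1) a a′) κ l = Kfib lapF κ l + a′·Kfib (qqF (m+1)) κ l − Kfib (gaugeF m a) κ l`. -/
theorem Kfib_X1aKer (a' : ℝ) (κ l : Fin 4) (x w : X 4) :
    Kfib (X1aKer (m + 1) a a') κ l x w
      = Kfib (lapF (d := 4)) κ l x w + a' * Kfib (qqF (d := 4) (m + 1)) κ l x w - Kfib (gaugeF m a) κ l x w := by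
  simp only [Kfib_apply, X1aKer_apply, lapF, qqF, gaugeF, Pgt_apply, Nat.add_sub_cancel]
  split_ifs <;> ring

/-! ## §2 Row bounds and the gauge sandwich entrywise -/

/-- [folklore] The rows of `codiffKer l` are absolutely summable with sum `≤ 2`. -/
theorem rowBound_codiffKer (l : Fin 4) : RowBound (codiffKer (d := 4) l) 2 := by
  intro x
  have hs : Summable fun w : X 4 => |codiffKer l x w| := (summable_codiffKer_row l x).abs
  refine ⟨hs, ?_⟩
  have hle : ∀ w : X 4, |codiffKer l x w| ≤ (if w = x - unitVec l then (1 : ℝ) else 0) + (if w = x then 1 else 0) := by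
    intro w; simp only [codiffKer]; split_ifs <;> simp
  have hsum : Summable fun w : X 4 => (if w = x - unitVec l then (1 : ℝ) else 0) + (if w = x then 1 else 0) :=
    (summable_of_ne_finset_zero (s := {x - unitVec l}) (fun w hw => by rw [Finset.mem_singleton] at hw; rw [if_neg hw])).add
      (summable_of_ne_finset_zero (s := {x}) (fun w hw => by rw [Finset.mem_singleton] at hw; rw [if_neg hw]))
  calc ∑' w, |codiffKer l x w| ≤ ∑' w : X 4, ((if w = x - unitVec l then (1 : ℝ) else 0) + (if w = x then 1 else 0)) :=
        hs.tsum_le_tsum hle hsum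
    _ = 2 := by
        rw [Summable.tsum_add (summable_of_ne_finset_zero (s := {x - unitVec l}) (fun w hw => by
          rw [Finset.mem_singleton] at hw; rw [if_neg hw])) (summable_of_ne_finset_zero (s := {x}) (fun w hw => by
          rw [Finset.mem_singleton] at hw; rw [if_neg hw])), tsum_ite_eq, tsum_ite_eq]; norm_num

variable (m) {p : ℕ} [NeZero p]

/-- [folklore] **THE GAUGE SANDWICH ENTRYWISE**: on the fine torus `Site 4 ((m+1)·p)`,
`(GradOp·P̂_ℂ·GradOpᴴ) i j = ↑((m+1)²·periodiseF ((m+1)·p) (gaugeF m a) i j)` (product rule twice over an4's Lemma-2.2.2 calculus). -/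
theorem gauge_sandwich_entry (ha : 0 < a) (i j : Site 4 ((m + 1) * p) × Fin 4) :
    (GradOp (fine (m + 1) (cubic 4 p)) ((m + 1 : ℕ) : ℂ) * PhatC m a p * (GradOp (fine (m + 1) (cubic 4 p)) ((m + 1 : ℕ) : ℂ))ᴴ) i j
      = (((((m + 1 : ℕ) : ℝ)) ^ 2 * periodiseF ((m + 1) * p) (gaugeF m a) i j : ℝ) : ℂ) := by
  obtain ⟨xb, κ⟩ := i
  obtain ⟨zb, l⟩ := j
  have hdiv : m + 1 ∣ (m + 1) * p := ⟨p, rfl⟩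
  -- the inner product `P̂ · codiff̂`
  have hin : Matrix.of (periodise₂ ((m + 1) * p) (compKer (Pker m a) (codiffKer l)))
      = Matrix.of (periodise₂ ((m + 1) * p) (Pker m a)) * Matrix.of (periodise₂ ((m + 1) * p) (codiffKer (d := 4) l)) :=
    periodise₂_compKer_matrix (summable_abs_row_Pker m ha) (isPeriodic₂_codiffKer l _) (rowBound_codiffKer l)
  -- the outer product `dẑ · (P̂ · codiff̂)`
  have hout : Matrix.of (periodise₂ ((m + 1) * p) (compKer (dzKer κ) (compKer (Pker m a) (codiffKer l))))
      = Matrix.of (periodise₂ ((m + 1) * p) (dzKer (d := 4) κ))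
          * Matrix.of (periodise₂ ((m + 1) * p) (compKer (Pker m a) (codiffKer l))) :=
    periodise₂_compKer_matrix (fun x => (summable_dzKer_row κ x).abs)
      (isPeriodic₂_compKer (isPeriodic₂_Pker m ha hdiv) (isPeriodic₂_codiffKer l _))
      (rowBound_compKer (rowBound_Pker m ha) (rowBound_codiffKer l))
  have key : periodiseF ((m + 1) * p) (gaugeF m a) (xb, κ) (zb, l)
      = ((Matrix.of (periodise₂ ((m + 1) * p) (dzKer (d := 4) κ)) * Matrix.of (periodise₂ ((m + 1) * p) (Pker m a))
          * Matrix.of (periodise₂ ((m + 1) * p) (codiffKer (d := 4) l)) :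
            Matrix (Site 4 ((m + 1) * p)) (Site 4 ((m + 1) * p)) ℝ) xb zb) := by
    rw [periodiseF_apply, ← compKer_dzKer_Pker_codiffKer, Matrix.mul_assoc, ← hin, ← hout, Matrix.of_apply]
  rw [key, Matrix.mul_apply, Matrix.mul_apply]
  simp only [Matrix.mul_apply, Matrix.of_apply, GradOp_entry_site, GradOp_conjTranspose_entry_site, PhatC_eq, Matrix.map_apply, Phat_apply]
  push_cast
  simp only [Finset.sum_mul, Finset.mul_sum]
  refine Finset.sum_congr rfl fun w _ => Finset.sum_congr rfl fun v _ => ?_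
  ring

/-! ## §3 `DeltaA` is the periodisation of `(m+1)²·X1aKer` -/

/-- [folklore] Rows of the fibres of `X1aKer` are summable (finite stencils + the block-decaying `P`). -/
theorem summable_Kfib_X1aKer (ha : 0 < a) (a' : ℝ) (κ l : Fin 4) (x : X 4) : Summable (Kfib (X1aKer (m + 1) a a') κ l x) := by
  have hL : Summable (Kfib (lapF (d := 4)) κ l x) := by
    rw [Kfib_lapF]; split_ifs
    · exact (summable_abs_lapKer_row x).of_abs
    · exact summable_zero
  have hQ : Summable (Kfib (qqF (d := 4) (m + 1)) κ l x) := by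
    rw [Kfib_qqF]; split_ifs
    · exact (summable_abs_qqKer_row (m + 1) κ x).of_abs
    · exact summable_zero
  have hG : Summable (Kfib (gaugeF m a) κ l x) := by
    rw [← compKer_dzKer_Pker_codiffKer]
    exact (summable_abs_compKer (summable_dzKer_row κ x).abs
      (rowBound_compKer (rowBound_Pker m ha) (rowBound_codiffKer l))).1.of_abs |>.congr fun w => rfl
  have e : Kfib (X1aKer (m + 1) a a') κ l x = fun w => Kfib (lapF (d := 4)) κ l x w + a' * Kfib (qqF (d := 4) (m + 1)) κ l x w
      - Kfib (gaugeF m a) κ l x w := funext fun w => Kfib_X1aKer a' κ l x w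
  rw [e]
  exact (hL.add (hQ.mul_left a')).sub hG

/-- [folklore] **`DeltaA_T = (m+1)²·periodiseF (X1aKer)`**, entrywise on the fine torus. -/
theorem DeltaA_eq_periodiseF (ha : 0 < a) (i j : Site 4 ((m + 1) * p) × Fin 4) :
    DeltaA (m + 1) (cubic 4 p) a i j
      = (((((m + 1 : ℕ) : ℝ)) ^ 2 * periodiseF ((m + 1) * p) (X1aKer (m + 1) a (a / ((m + 1 : ℕ) : ℝ) ^ 8)) i j : ℝ) : ℂ) := by
  have hm : (((m + 1 : ℕ) : ℝ)) ≠ 0 := by positivity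
  rw [DeltaA_eq_periodisedProjector m p ha a]
  simp only [Matrix.add_apply, Matrix.sub_apply, Matrix.smul_apply, smul_eq_mul, Lap_eq_periodiseF_site, QvAdj_QvOp_eq_periodiseF_site,
    gauge_sandwich_entry m ha]
  obtain ⟨xb, κ⟩ := i
  obtain ⟨zb, l⟩ := j
  simp only [periodiseF_apply]
  -- linearity of `periodise₂` over the fibre decomposition of `X1aKer`
  have hL : ∀ x, Summable (Kfib (lapF (d := 4)) κ l x) := fun x => by
    rw [Kfib_lapF]; split_ifs
    · exact (summable_abs_lapKer_row x).of_abs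
    · exact summable_zero
  have hQ : ∀ x, Summable (fun w => a / ((m + 1 : ℕ) : ℝ) ^ 8 * Kfib (qqF (d := 4) (m + 1)) κ l x w) := fun x => by
    refine Summable.mul_left _ ?_
    rw [Kfib_qqF]; split_ifs
    · exact (summable_abs_qqKer_row (m + 1) κ x).of_abs
    · exact summable_zero
  have hG : ∀ x, Summable (fun w => (-1 : ℝ) * Kfib (gaugeF m a) κ l x w) := fun x => by
    refine Summable.mul_left _ ?_
    rw [← compKer_dzKer_Pker_codiffKer]
    exact (summable_abs_compKer (summable_dzKer_row κ x).abs
      (rowBound_compKer (rowBound_Pker m ha) (rowBound_codiffKer l))).1.of_abs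
  have e : Kfib (X1aKer (m + 1) a (a / ((m + 1 : ℕ) : ℝ) ^ 8)) κ l
      = (Kfib (lapF (d := 4)) κ l + fun x w => a / ((m + 1 : ℕ) : ℝ) ^ 8 * Kfib (qqF (d := 4) (m + 1)) κ l x w)
        + fun x w => (-1 : ℝ) * Kfib (gaugeF m a) κ l x w := by
    funext x w
    simp only [Pi.add_apply]
    rw [Kfib_X1aKer]; ring
  have hLQ : ∀ x, Summable ((Kfib (lapF (d := 4)) κ l + fun x w => a / ((m + 1 : ℕ) : ℝ) ^ 8 * Kfib (qqF (d := 4) (m + 1)) κ l x w) x) :=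
    fun x => (hL x).add (hQ x)
  rw [e, periodise₂_add hLQ hG, periodise₂_add hL hQ, periodise₂_const_mul, periodise₂_const_mul]
  push_cast
  field_simp
  ring

/-! ## §4 Lemma 2.2.2: the periodised leg inverts the periodised operator -/

/-- [folklore] The fibres of the gluon leg are jointly `s`-periodic for `(m+1) ∣ s` (`Kinf_blockShift`). -/
theorem isPeriodic₂_GaF {s : ℕ} (hdiv : m + 1 ∣ s) (κ l : Fin 4) : IsPeriodic₂ s (Kfib (GaF (m + 1) a) κ l) :=
  (isPeriodic₂_KinfBlock (m + 1) a (Nat.succ_le_succ (Nat.zero_le m)) κ l).of_dvd hdiv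

/-- [folklore] A UNIFORM ROW BOUND for the fibres of the gluon leg, from its (displayed) exponential decay `Spr (Ga (m+1) a)`. -/
theorem exists_rowBound_GaF (hGa : Spr (Ga (m + 1) a)) : ∃ B : ℝ, ∀ κ l : Fin 4, RowBound (Kfib (GaF (m + 1) a) κ l) B := by
  obtain ⟨C, δ, hδ, hdec⟩ := hGa
  refine ⟨C * ∑' w : X 4, Real.exp (-δ * l1 w), fun κ l => ?_⟩
  have h2 : Decay₂ (Kfib (GaF (m + 1) a) κ l) C δ := fun x y => by
    simp only [Kfib_apply, GaF_apply]; exact hdec x y κ l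
  exact h2.rowBound hδ

/-- [folklore] Absolutely summable rows of the fibres of `X1aKer`. -/
theorem summable_abs_Kfib_X1aKer (ha : 0 < a) (a' : ℝ) (κ l : Fin 4) (x : X 4) :
    Summable fun y => |Kfib (X1aKer (m + 1) a a') κ l x y| :=
  (summable_Kfib_X1aKer m ha a' κ l x).abs

/-- [folklore] **LEMMA 2.2.2 FOR THE VECTOR LEG** (modulo `Spr (Ga …)`): on every fine torus `Site 4 ((m+1)·p)`,
`per(X1aKer) · per(GaF) = 1` and `per(GaF) · per(X1aKer) = 1` (`FibredPeriodisation.lemma222F` on `compF_X1aKer_GaF`). -/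
theorem periodiseF_X1aKer_mul_GaF (ha : 0 < a) (hGa : Spr (Ga (m + 1) a)) :
    Matrix.of (periodiseF ((m + 1) * p) (X1aKer (m + 1) a (a / ((m + 1 : ℕ) : ℝ) ^ 8))) * Matrix.of (periodiseF ((m + 1) * p) (GaF (m + 1) a)) = 1
      ∧ Matrix.of (periodiseF ((m + 1) * p) (GaF (m + 1) a)) * Matrix.of (periodiseF ((m + 1) * p) (X1aKer (m + 1) a (a / ((m + 1 : ℕ) : ℝ) ^ 8))) = 1 := by
  obtain ⟨B, hB⟩ := exists_rowBound_GaF m hGa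
  exact lemma222F (summable_abs_Kfib_X1aKer m ha _) (isPeriodic₂_GaF m ⟨p, rfl⟩) hB (compF_X1aKer_GaF m ha)

/-! ## §5 The method of images -/

/-- [folklore] `calG` has real entries (`calG_im_eq_zero`). -/
theorem isReal_calG (ha : 0 < a) (p : ℕ) [NeZero p] :
    IsReal (calG (m + 1) (Nat.succ_le_succ (Nat.zero_le m)) (cubic 4 p) a ha) :=
  fun i j => Complex.conj_eq_iff_im.2 (calG_im_eq_zero (m + 1) (Nat.succ_le_succ (Nat.zero_le m)) (cubic 4 p) a ha i j)

/-- [folklore] **THE PERIODISED GLUON LEG IS THE TORUS PROPAGATOR**: `periodiseF ((m+1)·p) (GaF (m+1) a) i j = (m+1)²·Re calG_T i j` for all fine-torus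
bond indices (modulo `Spr (Ga (m+1) a)`). -/
theorem periodiseF_GaF_eq_calG_re (ha : 0 < a) (hGa : Spr (Ga (m + 1) a)) (i j : Site 4 ((m + 1) * p) × Fin 4) :
    periodiseF ((m + 1) * p) (GaF (m + 1) a) i j
      = (((m + 1 : ℕ) : ℝ)) ^ 2 * (calG (m + 1) (Nat.succ_le_succ (Nat.zero_le m)) (cubic 4 p) a ha i j).re := by
  set P : Matrix (Site 4 ((m + 1) * p) × Fin 4) (Site 4 ((m + 1) * p) × Fin 4) ℝ :=
    Matrix.of (periodiseF ((m + 1) * p) (X1aKer (m + 1) a (a / ((m + 1 : ℕ) : ℝ) ^ 8))) with hP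
  set G : Matrix (Site 4 ((m + 1) * p) × Fin 4) (Site 4 ((m + 1) * p) × Fin 4) ℝ :=
    Matrix.of (periodiseF ((m + 1) * p) (GaF (m + 1) a)) with hG
  set D : Matrix (Site 4 ((m + 1) * p) × Fin 4) (Site 4 ((m + 1) * p) × Fin 4) ℝ := reM (DeltaA (m + 1) (cubic 4 p) a) with hD
  set C : Matrix (Site 4 ((m + 1) * p) × Fin 4) (Site 4 ((m + 1) * p) × Fin 4) ℝ :=
    reM (calG (m + 1) (Nat.succ_le_succ (Nat.zero_le m)) (cubic 4 p) a ha) with hC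
  have hDP : D = ((((m + 1 : ℕ) : ℝ)) ^ 2) • P := by
    ext i' j'
    rw [hD, reM_apply, DeltaA_eq_periodiseF m ha, Complex.ofReal_re, hP, Matrix.smul_apply, Matrix.of_apply, smul_eq_mul]
  have hDC : D * C = 1 := by
    rw [hD, hC, ← (isReal_DeltaA (m + 1) (cubic 4 p) a).reM_mul (isReal_calG m ha p), DeltaA_mul_calG, reM_one]
  have hGP : G * P = 1 := (periodiseF_X1aKer_mul_GaF m (p := p) ha hGa).2
  have key : G = ((((m + 1 : ℕ) : ℝ)) ^ 2) • C := by
    calc G = G * (D * C) := by rw [hDC, Matrix.mul_one]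
      _ = G * ((((((m + 1 : ℕ) : ℝ)) ^ 2) • P) * C) := by rw [hDP]
      _ = ((((m + 1 : ℕ) : ℝ)) ^ 2) • ((G * P) * C) := by rw [Matrix.smul_mul, Matrix.mul_smul, Matrix.mul_assoc]
      _ = ((((m + 1 : ℕ) : ℝ)) ^ 2) • C := by rw [hGP, Matrix.one_mul]
  have := congr_fun (congr_fun key i) j
  rw [hG, Matrix.of_apply] at this
  rw [this, Matrix.smul_apply, hC, reM_apply, smul_eq_mul]

/-- [folklore] **THE METHOD OF IMAGES FOR THE MASSIVE VECTOR PROPAGATOR** (`ℤ⁴` coordinates): for every `x y ∈ ℤ⁴`, `κ l`,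
`Σ'_{t ∈ ℤ⁴} Ga (m+1) a x (y + (m+1)p·t) κ l = (m+1)²·Re calG_T((castT x, κ), (castT y, l))` on the cubic fine torus of side `(m+1)·p` — MODULO the
exponential decay `Spr (Ga (m+1) a)` (printed [B5, Prop. 1.2] ∧ [B5, (1.126)–(1.127)], via `GluonLegTails.spr_Ga_of_prop12`). -/
theorem images_Ga_eq_calG_re (ha : 0 < a) (hGa : Spr (Ga (m + 1) a)) (x y : X 4) (κ l : Fin 4) :
    ∑' t : X 4, Ga (m + 1) a x (imageShift ((m + 1) * p) y t) κ l
      = (((m + 1 : ℕ) : ℝ)) ^ 2 * (calG (m + 1) (Nat.succ_le_succ (Nat.zero_le m)) (cubic 4 p) a ha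
          (castT (fine (m + 1) (cubic 4 p)) x, κ) (castT (fine (m + 1) (cubic 4 p)) y, l)).re := by
  obtain ⟨B, hB⟩ := exists_rowBound_GaF m hGa
  have h := periodiseF_GaF_eq_calG_re m (p := p) ha hGa (siteOf 4 ((m + 1) * p) x, κ) (siteOf 4 ((m + 1) * p) y, l)
  rw [periodiseF_apply, periodise₂_eq_tsum_of_rep (isPeriodic₂_GaF m ⟨p, rfl⟩ κ l) ((hB κ l).summable) rfl rfl] at h
  have e1 : castT (fine (m + 1) (cubic 4 p)) x = siteOf 4 ((m + 1) * p) x := rfl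
  have e2 : castT (fine (m + 1) (cubic 4 p)) y = siteOf 4 ((m + 1) * p) y := rfl
  rw [e1, e2]
  simpa only [Kfib_apply, GaF_apply] using h

end

end Summit.QuantumFields.BalabanUV.Beta.D1BFx.VectorPropagatorImages
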